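import Summits.Schanuel.Schanuel.Theorems.ZilberEacExpExpBalanceGeneral
import Summits.Schanuel.Schanuel.Theorems.ZilberEacExpExpDensity
import HarnessLib

/-!
# Density over graph bases of EVERY degree `≥ 2` with a moving target: no sign condition

Zilber's Exponential-Algebraic Closedness, case ladder (host summit Schanuel, cell `pub-schanuel`,
seat 2, gen 8).  THE RESULT: for EVERY `p ∈ ℂ[x]` with `deg p ≥ 2`, EVERY `A ∈ ℂ[x]` and every
`F ∈ ℂ[u] ∖ {0}` the exponential points of the moving-target surface
`{x₁ = p(x₀), y₀ = A(x₀) + y₁ F(y₁)} ⊆ ℂ² × ℂ²` — the solutions of `e^{z} = A(z) + e^{p(z)}F(e^{p(z)})` —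
are ZARISKI DENSE (`unprojectedDense_movingGraph_of_two_le`); with `deg A ≥ 1` the surface is in
Mantova–Masser's case and free, so these are positive instances of the (free) typed density question
with NO condition on the leading coefficient of `p` (`unprojectedDensityQuestion_instance_movingGraph_all`).
Degree `≥ 3`: `unprojectedDense_movingGraph_of_three_le` (exp–exp balance
`exists_solution_expExp_general` + THEOREM G along `k = m^D`); degree `2`:
`unprojectedDense_movingGraph_quadratic`.  Example in the explosion regime of degree `4`:
`e^{z} = z + e^{z⁴}` (`unprojectedDensityQuestion_instance_quartic`).

HONEST FRAMING: instances of Mantova–Masser's OPEN density question (existence is their Thm 1.1);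
`x₀`-dependent fibre polynomials `F ∈ ℂ[u, x₀]` in the explosion regime, lines (`deg p = 1`, done in
`ZilberEacMovingLineAll` for `F ∈ ℂ[u]`), and `EC(3,2)` are not touched here; NOT Schanuel's
conjecture; EAC ⇏ SC.
-/

noncomputable section

open Complex MvPolynomial Filter Topology
open Literature.NumberTheory.Transcendental Literature.ModelTheory.Zilber

set_option linter.dupNamespace false

namespace Summit.Schanuel.Schanuel.Theorems

/-- **Density over every graph base of degree `D ≥ 3`.**  ANY `A ∈ ℂ[x]`, `F ≠ 0`: the exponential
points of `{x₁ = p(x₀), y₀ = A(x₀) + y₁ F(y₁)}` are Zariski dense (THEOREM G on `x₁ = p(z)` along the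
solutions `z_{m^D}` of the balance: `|Re x₁|/log(2 + ‖x₁‖) ≥ ρ m/(log(2 + C) + D log m) → ∞`).
(new) [cite: MantovaMasser2023, §1 Further remarks] -/
theorem unprojectedDense_movingGraph_of_three_le (p : Polynomial ℂ) (hD : 3 ≤ p.natDegree)
    (A : Polynomial ℂ) {F : Polynomial ℂ} (hF : F ≠ 0) :
    UnprojectedDense (movingGraphSurface p A (F.toMvPolynomial 0)) := by
  classical
  set D : ℕ := p.natDegree with hDdef
  have hD0 : D ≠ 0 := by omega
  have hDpos : (0 : ℝ) < D := by exact_mod_cast (show 0 < D by omega)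
  obtain ⟨ρ, C, hρ, hev⟩ := exists_solution_expExp_general p hD A hF
  obtain ⟨k₀, hk₀⟩ := eventually_atTop.1 hev
  -- solutions at `k = max (m^D) k₀`
  have hsol : ∀ m : ℕ, ∃ z : ℂ,
      exp z = A.eval z + exp (p.eval z) * F.eval (exp (p.eval z)) ∧
      ρ * (((max (m ^ D) k₀ : ℕ) : ℝ)) ^ ((D : ℝ)⁻¹) ≤ (p.eval z).re ∧
      ‖p.eval z‖ ≤ C * ((max (m ^ D) k₀ : ℕ) : ℝ) := fun m =>
    hk₀ (max (m ^ D) k₀) (le_max_right _ _)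
  choose z hz using hsol
  set pt : ℕ → Fin 2 ⊕ Fin 2 → ℂ := fun m =>
    Sum.elim ![z m, p.eval (z m)] ![exp (z m), exp (p.eval (z m))] with hpt
  have hpS : ∀ m, pt m ∈ movingGraphSurface p A (F.toMvPolynomial 0) := by
    intro m
    rw [mem_movingGraphSurface_iff]
    constructor
    · rfl
    · simp only [hpt, Sum.elim_inl, Sum.elim_inr, Matrix.cons_val_zero, Matrix.cons_val_one,
        MvPolynomial.eval_toMvPolynomial]
      exact (hz m).1
  have hpΓ : ∀ m, pt m ∈ expGraph ℂ 2 := by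
    intro m
    rw [mem_expGraph_iff]
    intro i
    rw [Literature.ModelTheory.ExponentialFields.ExponentialRing.complex_exp_eq]
    fin_cases i <;> rfl
  refine unprojectedDense_of_growth (isIrreducibleClosed_polyFibredGraph _ _ _)
    (zariskiDim_polyFibredGraph _ _ _).le 1 hpS hpΓ ?_
  show Tendsto (fun m => |(p.eval (z m)).re| / Real.log (2 + ‖p.eval (z m)‖)) atTop atTop
  set C' : ℝ := max C 0 with hC'
  have hC'0 : 0 ≤ C' := le_max_right _ _
  have hApos : 0 < Real.log (2 + C') := Real.log_pos (by linarith)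
  have hlow := (tendsto_div_const_add_mul_log hApos hDpos.le).const_mul_atTop hρ
  refine tendsto_atTop_mono' atTop ?_ hlow
  filter_upwards [eventually_ge_atTop (max k₀ 1)] with m hm
  have hm1 : 1 ≤ m := le_of_max_le_right hm
  have hm1' : (1 : ℝ) ≤ m := by exact_mod_cast hm1
  have hmk : k₀ ≤ m ^ D := (le_of_max_le_left hm).trans (Nat.le_self_pow hD0 m)
  have hmax : max (m ^ D) k₀ = m ^ D := max_eq_left hmk
  obtain ⟨-, hre, hnorm⟩ := hz m
  rw [hmax] at hre hnorm
  push_cast at hre hnorm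
  rw [Real.pow_rpow_inv_natCast (by positivity) hD0] at hre
  have hnum : ρ * m ≤ |(p.eval (z m)).re| := hre.trans (le_abs_self _)
  have hmD : (1 : ℝ) ≤ (m : ℝ) ^ D := one_le_pow₀ hm1'
  have hnorm' : ‖p.eval (z m)‖ ≤ C' * (m : ℝ) ^ D :=
    hnorm.trans (mul_le_mul_of_nonneg_right (le_max_left _ _) (by positivity))
  have hden : Real.log (2 + ‖p.eval (z m)‖) ≤ Real.log (2 + C') + D * Real.log m := by
    calc Real.log (2 + ‖p.eval (z m)‖) ≤ Real.log ((2 + C') * (m : ℝ) ^ D) := by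
          refine Real.log_le_log (by positivity) ?_
          nlinarith
      _ = Real.log (2 + C') + D * Real.log m := by
          rw [Real.log_mul (by positivity) (by positivity), Real.log_pow]
  have hdenpos : 0 < Real.log (2 + ‖p.eval (z m)‖) :=
    Real.log_pos (by linarith [norm_nonneg (p.eval (z m))])
  calc ρ * ((m : ℝ) / (Real.log (2 + C') + D * Real.log m))
      = (ρ * m) / (Real.log (2 + C') + D * Real.log m) := by ring
    _ ≤ |(p.eval (z m)).re| / (Real.log (2 + C') + D * Real.log m) :=
        div_le_div_of_nonneg_right hnum (by nlinarith [Real.log_natCast_nonneg m])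
    _ ≤ |(p.eval (z m)).re| / Real.log (2 + ‖p.eval (z m)‖) :=
        div_le_div_of_nonneg_left (abs_nonneg _) hdenpos hden

/-- **Density over EVERY graph base of degree `≥ 2`** (ANY `A ∈ ℂ[x]`, `F ≠ 0`, NO condition on the
leading coefficient): the exponential points of `{x₁ = p(x₀), y₀ = A(x₀) + y₁ F(y₁)}` are Zariski
dense. (new) [cite: MantovaMasser2023, §1 Further remarks] -/
theorem unprojectedDense_movingGraph_of_two_le {p : Polynomial ℂ} (hp : 2 ≤ p.natDegree)
    (A : Polynomial ℂ) {F : Polynomial ℂ} (hF : F ≠ 0) :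
    UnprojectedDense (movingGraphSurface p A (F.toMvPolynomial 0)) := by
  rcases Nat.lt_or_ge p.natDegree 3 with h | h
  · have h2 : p.natDegree = 2 := by omega
    have hlc : p.coeff 2 ≠ 0 := by
      rw [← h2]; exact Polynomial.leadingCoeff_ne_zero.2 (by rintro rfl; simp at h2)
    have hpeq : p = Polynomial.C (p.coeff 2) * Polynomial.X ^ 2 + Polynomial.C (p.coeff 1) *
        Polynomial.X + Polynomial.C (p.coeff 0) := by
      conv_lhs => rw [p.as_sum_range_C_mul_X_pow, h2]
      simp [Finset.sum_range_succ]
      ring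
    rw [hpeq]
    exact unprojectedDense_movingGraph_quadratic hlc _ _ A hF
  · exact unprojectedDense_movingGraph_of_three_le p h A hF

/-- **Positive instances of the FREE typed question over every graph base of degree `≥ 2`**
(`deg A ≥ 1`, `F ≠ 0`): the surface is in Mantova–Masser's case, free, and its exponential points
are dense — whatever the leading coefficient of `p`. (new) [cite: MantovaMasser2023, §1 Further remarks] -/
theorem unprojectedDensityQuestion_instance_movingGraph_all {p : Polynomial ℂ} (hp : 2 ≤ p.natDegree)
    {A : Polynomial ℂ} (hA : 0 < A.natDegree) {F : Polynomial ℂ} (hF : F ≠ 0) :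
    MMCaseDimPiOneFree (movingGraphSurface p A (F.toMvPolynomial 0)) ∧
      IsMulFree ℂ 2 (movingGraphSurface p A (F.toMvPolynomial 0) ∩ torusLocus ℂ 2) ∧
      UnprojectedDense (movingGraphSurface p A (F.toMvPolynomial 0)) := by
  obtain ⟨h1, h2⟩ := mmCase_movingGraph_of_two_le hp hA (F.toMvPolynomial 0)
  exact ⟨h1, h2, unprojectedDense_movingGraph_of_two_le hp A hF⟩

/-- **Example (explosion regime, degree 4)**: `e^{z} = z + e^{z⁴}` — the exponential points of
`{x₁ = x₀⁴, y₀ = x₀ + y₁}` (`Re(1 · i⁴) = 1 > 0`, `Re z⁴ → +∞` along every lattice ray) are Zariski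
dense; the surface is in the case and free. (new) -/
theorem unprojectedDensityQuestion_instance_quartic :
    MMCaseDimPiOneFree (movingGraphSurface (Polynomial.X ^ 4) Polynomial.X
        ((1 : Polynomial ℂ).toMvPolynomial 0)) ∧
      IsMulFree ℂ 2 (movingGraphSurface (Polynomial.X ^ 4) Polynomial.X
        ((1 : Polynomial ℂ).toMvPolynomial 0) ∩ torusLocus ℂ 2) ∧
      UnprojectedDense (movingGraphSurface (Polynomial.X ^ 4) Polynomial.X
        ((1 : Polynomial ℂ).toMvPolynomial 0)) :=
  unprojectedDensityQuestion_instance_movingGraph_all (by rw [Polynomial.natDegree_X_pow]; norm_num)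
    (by rw [Polynomial.natDegree_X]; exact one_pos) one_ne_zero

/-- … in particular `e^{z} = z + e^{z⁴}` has (Zariski-densely many, here: some) complex solutions.
(new) -/
theorem exists_exp_eq_self_add_exp_pow_four : ∃ z : ℂ, exp z = z + exp (z ^ 4) := by
  obtain ⟨ρ, C, -, hev⟩ := exists_solution_expExp_general (Polynomial.X ^ 4 : Polynomial ℂ)
    (by rw [Polynomial.natDegree_X_pow]; norm_num) Polynomial.X (F := 1) one_ne_zero
  obtain ⟨-, z, hz, -, -⟩ := hev.exists
  refine ⟨z, ?_⟩
  rw [hz]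
  simp

end Summit.Schanuel.Schanuel.Theorems

end
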